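import Summits.BirchSwinnertonDyer.BirchSwinnertonDyer.Theorems.AdditiveBranchIMCGordTwoRankZeroOffCaseOneFieldSupplyR0Local
import Summits.BirchSwinnertonDyer.BirchSwinnertonDyer.Theorems.AdditiveBranchIMCGordTwoRankZeroOffCaseOnePartnerLowerSU
import Literature.NumberTheory.EllipticCurves.NonvanishingTwistsPrescribedSplittingOfHoffsteinLuoProofs
import Literature.NumberTheory.EllipticCurves.NonvanishingTwistsPrescribedRamificationSimpleZero
import Literature.NumberTheory.EllipticCurves.NonvanishingTwistsHoffsteinLuo
import Literature.NumberTheory.EllipticCurves.BSDQuadraticDescent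
import Literature.NumberTheory.EllipticCurves.BSDRootNumber
import Literature.NumberTheory.EllipticCurves.GrossZagierRationalPoint
import Literature.NumberTheory.EllipticCurves.LeadingTerm
import Literature.NumberTheory.EllipticCurves.Tamagawa
import Literature.NumberTheory.EllipticCurves.Hsieh2014.AnticyclotomicPAdicLFunctionRamifiedSteinberg
import Literature.NumberTheory.EllipticCurves.LiuZhangZhang2018.PAdicWaldspurgerEllipticCurveAdditiveRamifiedSteinberg
import Literature.NumberTheory.EllipticCurves.CaiShuTian2014.ExplicitGrossZagier
import Literature.NumberTheory.EllipticCurves.CaiShuTian2014.ExplicitGrossZagierRingClass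
import Literature.NumberTheory.EllipticCurves.Voight2007.RingClassGenusField
import Literature.NumberTheory.EllipticCurves.ManinConstantSemistablePrimewise
import Literature.NumberTheory.EllipticCurves.Gross2004.RationalCharacterLSeries
import HarnessLib

/-!
# Registered stub `stub_fieldSupplyR0` of line `three_field_road` (v4) — PROVED, BY NAME AND SIGNATURE
# (crux `AdditiveBranchIMC.GordTwoRankZeroOffCaseOne`, stmt-BirchSwinnertonDyer-19357, route K1
# `AdditiveBranchIMC`; stub-worker `bsd-line-addord-w2` under LEAD `cruxlead-stmt-BirchSwinnertonDyer-19357`)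

HONEST FRAMING. One theorem and six `def … : Prop` (LINE VOCABULARY repeated verbatim from the skeleton
`Cruxes/GordTwoRankZeroOffCaseOne/Lines/three_field_road.lean` v4 — `WanPrime`, `TameRoadRow`,
`ThreeFieldRow`, `TameRoadField`, `RamifiedKolyvaginField`, and the cite-only conjunction `PrintedFactsR0`
(16 conjuncts, the pen's v4 with `HoffsteinLuo1997_exists_twist_L_one_ne_zero` LAST) — so that the stub can
be stated by name and signature under the Theorems import fence; the constants are definitionally equal to
the skeleton's, nothing is asserted by them). No named fact, no `sorry`; BSD is proved for no curve; the
crux item stays OPEN.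

THE STUB (FIELDS 1 AND 2 WITH THEIR CURVES). On the sub-row `ThreeFieldRow` in analytic rank `0`:
FIELD 1 (`exists_fieldOne_gordTwo_rankZero`, file `…FieldSupplyR0TameTwist`): parity ⟹ `w(E) = +1`;
F6 at the Wan prime `q` and the auxiliary prime `p` ⟹ the tame-road field `K` and a simple zero of
`L(E^{(d_K)}, s)`; the globally minimal twist `Wd` has `r_an = 1`, lies on the (G-ord, `e = 2`) cell
(`p*`-partners), `ρ̄` onto, `p ∤ ∏ c(Wd)`. FIELD 2 (`exists_fieldTwo_gordTwo`, files `…FieldSupplyR0Arith`,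
`…Partner`, `…Aux`, `…Class`, `…Local`): the good-ordinary partner `V ≅ E^{(p*)}`, a Dirichlet prime `ℓ₀`,
the auxiliary twist `X ≅ V^{(δ₁ℓ₀*)}` of root number `−1` (Jacobi reciprocity), Friedberg–Hoffstein Thm. B
with prescribed splitting — here DERIVED from conjunct 16 (Hoffstein–Luo 1997) and modularity
(`friedbergHoffstein_exists_heegnerField_splitDivisors_twist_ne_zero_of_hoffsteinLuo`) — the field
`K'' = ℚ(√(p*q*ℓ₀*d))` and the rank-zero partner `A ≅ Wd^{(d_{K''})} ≅ E^{(u)}`, with the local analysis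
at `q` (non-split, `p ∤ v_q(Δ_A)`), at `p` (good ordinary) and of `∏ c(A)`.

References: [cite: FriedbergHoffstein1995, Thm. B] [cite: HoffsteinLuo1997, Theorem (§1, pp. 435–436)]
[cite: JetchevSkinnerWan2017, §7.4.1 (p. 30)] [cite: SilvermanAEC2009, X.5 Cor. 5.4, VII.6.1, App. C §16].
Axioms: `propext`, `Classical.choice`, `Quot.sound`.
-/

set_option autoImplicit false
-- D-0017: single-problem summit, so `Summit.BirchSwinnertonDyer.BirchSwinnertonDyer.…` repeats a namespace BY DESIGN.
set_option linter.dupNamespace false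

noncomputable section

open scoped Classical

namespace Summit.BirchSwinnertonDyer.BirchSwinnertonDyer.Theorems.ThreeFieldRoadSupply

open NumberField IsDedekindDomain
open WeierstrassCurve Literature.NumberTheory.EllipticCurves
  Literature.NumberTheory.EllipticCurves.ModularForms
  Literature.NumberTheory.EllipticCurves.Rank1Residual
  Literature.NumberTheory.EllipticCurves.Rank1Residual.Typed
open Summit.BirchSwinnertonDyer.Rank1Residual
open Summit.BirchSwinnertonDyer.Rank1Residual.Additive
open Field Literature.NumberTheory.EllipticCurves.ModularForms

/-! ### Line vocabulary (verbatim from the skeleton; nothing asserted) -/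

/-- The WAN PRIME: `q ≠ p`, `q ≠ 2`, NON-SPLIT multiplicative for `E` (`a_q = −1`), `ρ̄_{E,p}` ramified at
`q` (`p ∤ v_q(Δ_min)`). Verbatim the skeleton's `WanPrime`. [predicate; nothing asserted] -/
def WanPrime (W : WeierstrassCurve ℚ) [W.IsGloballyMinimal] (p q : ℕ) [Fact q.Prime] : Prop :=
  q ≠ p ∧ q ≠ 2 ∧ W.HasMultiplicativeReductionAtPrime q ∧ ¬ W.HasSplitMultiplicativeReductionAtPrime q ∧
    ¬ p ∣ padicValInt q W.minimalDiscriminantInt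

/-- The tame sub-row: `p ≥ 5`, `ρ̄_{E,p}` onto, `E` semistable outside `p`, a Wan prime. Verbatim the
skeleton's `TameRoadRow`. [predicate; nothing asserted] -/
def TameRoadRow (W : WeierstrassCurve ℚ) [W.IsGloballyMinimal] (p : ℕ) [Fact p.Prime] : Prop :=
  5 ≤ p ∧ Surj W p ∧
    (∀ ℓ : ℕ, (hℓ : ℓ.Prime) → ℓ ≠ p →
      (haveI : Fact ℓ.Prime := ⟨hℓ⟩;
        W.HasGoodReductionAtPrime ℓ ∨ W.HasMultiplicativeReductionAtPrime ℓ)) ∧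
    ∃ q : ℕ, ∃ _ : Fact q.Prime, WanPrime W p q

/-- THE SUB-ROW OF THE LINE: the tame sub-row with `p ∤ ∏_ℓ c_ℓ(E)`. Verbatim the skeleton's `ThreeFieldRow`.
[predicate; nothing asserted] -/
def ThreeFieldRow (W : WeierstrassCurve ℚ) [W.IsGloballyMinimal] (p : ℕ) [Fact p.Prime] : Prop :=
  TameRoadRow W p ∧ ¬ p ∣ W.tamagawaProduct

/-- The TAME-ROAD FIELD at `(E, p)`: imaginary quadratic `K`, a Wan prime `q` ramified, every other prime
of `N_E` split, `2` split if `2 ∤ N_E`, `p` split. Verbatim the skeleton's `TameRoadField`.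
[predicate; nothing asserted] -/
def TameRoadField (W : WeierstrassCurve ℚ) [W.IsGloballyMinimal] (p : ℕ)
    (K : Type) [Field K] [NumberField K] : Prop :=
  IsImaginaryQuadratic K ∧
    (∃ q : ℕ, ∃ _ : Fact q.Prime, WanPrime W p q ∧ (q : ℤ) ∣ NumberField.discr K ∧
      ∀ ℓ : ℕ, ℓ.Prime → ℓ ∣ W.conductorNorm ℤ → ℓ ≠ q →
        ((Ideal.span {(ℓ : ℤ)}).primesOver (𝓞 K)).ncard = 2) ∧
    (¬ 2 ∣ W.conductorNorm ℤ → ((Ideal.span {(2 : ℤ)}).primesOver (𝓞 K)).ncard = 2) ∧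
    SatisfiesHeegnerHypothesis p K

/-- THE `p`-RAMIFIED KOLYVAGIN FIELD of the pair `(Wd, A)` at `p`. Verbatim the skeleton's
`RamifiedKolyvaginField`. [predicate; nothing asserted] -/
def RamifiedKolyvaginField (Wd A : WeierstrassCurve ℚ) (p : ℕ)
    (K'' : Type) [Field K''] [NumberField K''] : Prop :=
  IsImaginaryQuadratic K'' ∧ (p : ℤ) ∣ NumberField.discr K'' ∧
    (∀ ℓ : ℕ, ℓ.Prime → ℓ ∣ Wd.conductorNorm ℤ → ¬ (ℓ : ℤ) ∣ NumberField.discr K'' →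
      SatisfiesHeegnerHypothesis ℓ K'') ∧
    (∀ ℓ : ℕ, (hℓ : ℓ.Prime) → ℓ ∣ Wd.conductorNorm ℤ → (ℓ : ℤ) ∣ NumberField.discr K'' → ℓ ≠ p →
      (haveI : Fact ℓ.Prime := ⟨hℓ⟩;
        A.HasMultiplicativeReductionAtPrime ℓ ∧ ¬ A.HasSplitMultiplicativeReductionAtPrime ℓ))

/-- The printed theorems the road consumes BY NAME — cite-only conjunction, VERBATIM the skeleton's
`PrintedFactsR0` (v4, sixteen conjuncts; the last is Hoffstein–Luo 1997). Line vocabulary repeated so that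
the registered stub can be stated by name and signature under the Theorems import fence; NOTHING IS
ASSERTED (each conjunct is an existing tree `Prop`, cited where it is declared). -/
def PrintedFactsR0 : Prop :=
  friedbergHoffstein_exists_twist_simpleZero_ramifiedAt_splitAt ∧
    (∀ W : WeierstrassCurve ℚ,
      Literature.NumberTheory.EllipticCurves.even_analyticRank_iff_rootNumber_eq_one W) ∧
    WeierstrassCurve.hasEntireLFunction_rat ∧
    Literature.NumberTheory.EllipticCurves.rank_eq_analyticRank_of_analyticRank_le_one ∧
    WeierstrassCurve.bsdRHS_eq_of_isIsogenous ∧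
    Literature.NumberTheory.EllipticCurves.ModularForms.nonempty_modularParametrizationData ∧
    Literature.NumberTheory.EllipticCurves.GrossZagier1986_thm_I_7_3 ∧
    Literature.NumberTheory.EllipticCurves.padicValRat_bsd_rank_zero ∧
    CaiShuTian2014.thm11_trivialChar ∧
    CaiShuTian2014.thm11_ringClassChar ∧
    Gross2004.rankinLSeries_eq_mul_quadraticTwist ∧
    Voight2007.prop38_sqrt_mem_ringClassField_iff ∧
    mazur_not_dvd_maninConstant_of_odd ∧
    Hsieh2014.thmB_exists_isHsiehLFunction_coeff_norm_eq_one_unrPeriod_ramifiedSteinberg ∧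
    LiuZhangZhang2018.thm151_thm153_modularCurve_heegnerVector_additive_ramifiedSteinberg ∧
    Literature.NumberTheory.EllipticCurves.HoffsteinLuo1997_exists_twist_L_one_ne_zero

/-! ### The stub -/

/-- **Registered stub `stub_fieldSupplyR0` of line `three_field_road`** (crux `GordTwoRankZeroOffCaseOne`,
stmt-BirchSwinnertonDyer-19357), BY NAME AND SIGNATURE — FIELDS 1 AND 2 WITH THEIR CURVES: on the
sub-row in analytic rank `0`, a tame-road field `K` with a globally minimal rank-one twist `Wd` on the same
cell (`ρ̄` onto, `p ∤ ∏ c(Wd)`), and a `p`-ramified Kolyvagin field `K''` with a free ramified prime and a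
globally minimal rank-zero good-ordinary partner `A ≅ Wd^{(d_{K''})}` (`ρ̄` onto, a multiplicative prime
with `p ∤ v(Δ)`, `p ∤ ∏ c(A)`). Proof: `exists_fieldOne_gordTwo_rankZero` (conjuncts 1–3 of
`PrintedFactsR0`) and `exists_fieldTwo_gordTwo` (conjuncts 3, 6, 16: modularity, a parametrisation datum
for `exists_isNewformOf`, and Hoffstein–Luo for Friedberg–Hoffstein with prescribed splitting).
[cite: FriedbergHoffstein1995, Thm. B] [cite: HoffsteinLuo1997, Theorem (§1, pp. 435–436)]
[cite: SilvermanAEC2009, X.5 Cor. 5.4 and Thm VII.6.1] -/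
theorem stub_fieldSupplyR0 : PrintedFactsR0 →
    ∀ (W : WeierstrassCurve ℚ) [W.IsElliptic] [W.IsGloballyMinimal] (p : ℕ) [Fact p.Prime],
      W.analyticRank = 0 → N10.CellGordTwo W p → ThreeFieldRow W p →
        ∃ (K : Type) (_ : Field K) (_ : NumberField K)
          (Wd : WeierstrassCurve ℚ) (_ : Wd.IsElliptic) (_ : Wd.IsGloballyMinimal)
          (K'' : Type) (_ : Field K'') (_ : NumberField K'')
          (A : WeierstrassCurve ℚ) (_ : A.IsElliptic) (_ : A.IsGloballyMinimal),
          TameRoadField W p K ∧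
          (∃ C : WeierstrassCurve.VariableChange ℚ, C • W.quadraticTwist (NumberField.discr K : ℚ) = Wd) ∧
          Wd.analyticRank = 1 ∧ N10.CellGordTwo Wd p ∧ Surj Wd p ∧ ¬ p ∣ Wd.tamagawaProduct ∧
          RamifiedKolyvaginField Wd A p K'' ∧
          (∃ ℓ : ℕ, ℓ.Prime ∧ (ℓ : ℤ) ∣ NumberField.discr K'' ∧ ℓ ≠ p ∧ ¬ ℓ ∣ Wd.conductorNorm ℤ) ∧
          (∃ C : WeierstrassCurve.VariableChange ℚ,
              C • Wd.quadraticTwist (NumberField.discr K'' : ℚ) = A) ∧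
          A.analyticRank = 0 ∧ GoodOrd A p ∧ Surj A p ∧
          (∃ ℓ : ℕ, ∃ _ : Fact ℓ.Prime, ℓ ≠ p ∧ A.HasMultiplicativeReductionAtPrime ℓ ∧
              ¬ p ∣ padicValInt ℓ A.minimalDiscriminantInt) ∧
          ¬ p ∣ A.tamagawaProduct := by
  intro hF W _ _ p _ hr hcell hrow
  obtain ⟨hF6, hpar, hmod, -, -, hmodP, -, -, -, -, -, -, -, -, -, hHL⟩ := hF
  have hnf : exists_isNewformOf := exists_isNewformOf_of_nonempty_modularParametrizationData hmodP
  have hFH : friedbergHoffstein_exists_heegnerField_splitDivisors_twist_ne_zero :=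
    friedbergHoffstein_exists_heegnerField_splitDivisors_twist_ne_zero_of_hoffsteinLuo hnf hHL
  obtain ⟨⟨hp5, hsurj, -, q, hqF, hqp, hq2, hqm, hqns, hqv⟩, htam⟩ := hrow
  -- FIELD 1
  obtain ⟨K, iF, iN, Wd, iWd, iWdm, hK, hqd, hsplit, h2, hpK, h2K, ⟨Cd, hWd⟩, hrd, hcelld, hsurjd, htamd⟩ :=
    exists_fieldOne_gordTwo_rankZero W p hF6 hpar hmod hp5 hr hcell hsurj htam hqp hq2 hqm hqns hqv
  -- FIELD 2
  have hw : W.rootNumber = 1 := (rootNumber_of_analyticRank_le_one W hpar).1 hr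
  obtain ⟨K'', iF'', iN'', A, iA, iAm, hRKF, hfree, hAWd, hrA, hgoA, hsurjA, hram, htamA⟩ :=
    exists_fieldTwo_gordTwo W p K hFH hnf hmod hp5 hw hcell hsurj htam hqp hq2 hqm hqns hqv hK h2K hqd
      hsplit Cd hWd
  exact ⟨K, iF, iN, Wd, iWd, iWdm, K'', iF'', iN'', A, iA, iAm,
    ⟨hK, ⟨q, hqF, ⟨hqp, hq2, hqm, hqns, hqv⟩, hqd, hsplit⟩, h2, hpK⟩, ⟨Cd, hWd⟩, hrd, hcelld, hsurjd, htamd,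
    hRKF, hfree, hAWd, hrA, hgoA, hsurjA, hram, htamA⟩

end Summit.BirchSwinnertonDyer.BirchSwinnertonDyer.Theorems.ThreeFieldRoadSupply

end
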